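import Literature.NumberTheory.GaloisRepresentations.QuarticTwistHeckeCharacterDatum
import Literature.NumberTheory.GaloisRepresentations.CharacterNormalisedGeneratorHeckeCharacter
import Literature.NumberTheory.GaloisRepresentations.BiquadraticReciprocitySupplement
import Literature.NumberTheory.GaloisRepresentations.BiquadraticReciprocityRationalInteger
import Literature.NumberTheory.GaloisRepresentations.GrossencharakterAlgebra
import Mathlib.NumberTheory.LSeries.PrimesInAP
import Mathlib.NumberTheory.NumberField.Cyclotomic.Embeddings
import HarnessLib

/-!
# The Hecke character of `y² = x³ − Dx` is RAMIFIED at the prime of `ℚ(i)` over `2`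
# (first half of the conductor statement of Ireland–Rosen Ch. 18 §6–7 / Deuring: `N_E = N(𝔣_ψ)·|d_K|`)

Topic `NumberTheory/GaloisRepresentations`; namespace `Literature.NumberTheory.GaloisRepresentations.QuarticTwistDatum`.
Theorems only. Sequel of `QuarticTwistHeckeCharacterDatum`: for `D ≠ 0` free of fourth powers and the algebraic Hecke character
`ψ = heckeOfGross` of the datum `ψ₀(𝔭) = e((D/ϖ_𝔭)₄³)·e(ϖ_𝔭) mod (8D)`, `ψ` is ramified at every place `w ∣ (8D)`, i.e. at every
`w ∣ 2D`. The method is the tree's unit-witness criterion `not_isUnramifiedAt_heckeOfGross_of_ne`: an `a ∈ 𝓞 K`, `a ∉ w`, prime to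
`(8D)`, `a ≡ 1` modulo the part of `(8D)` prime to `w`, with `ψ̃₀((a)) ≠ e(a)`.

* §1 modulus bookkeeping (`le_pow_modulusExp`, the complementary modulus `∏_{v ≠ w} 𝔭_v^{n_v + 8}` and its congruences);
* §2 `idealPow_gen_span` — `ψ̃₀((a)) = e((D/(a))₄³)·e(a)` for `a ≡ 1 (2 + 2i)` prime to `2D`;
* §3 ★ `not_isUnramifiedAt_gen_two` — at the prime over `2`: witness a Dirichlet prime `q ≡ 3 (4)`, `q ≡ 1 (mod D_oddᴺ)`, `q > 8|D|`,
  where `ψ̃₀((q)) = −q ≠ q` (the inert value);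
The odd primes of `D` and the assembled statement are the sequel `QuarticTwistHeckeCharacterRamification`.

## References
* K. Ireland, M. Rosen, *A Classical Introduction to Modern Number Theory*, 2nd ed. (1990), Ch. 18 §6 Theorem 7, §7 (conductor `(8D)`);
  Ch. 9 §9 Prop. 9.9.8. [IrelandRosen1990]
* J. H. Silverman, *Advanced Topics in the Arithmetic of Elliptic Curves* (1994), II Thm. 9.2, Thm. 10.5 (conductor of `ψ_E`). [SilvermanATAEC1994]
* J. Neukirch, *Algebraic Number Theory* (1999), Ch. VII §6 (6.14). [NeukirchANT1999]

## Mathlib / tree search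
Tree: `not_isUnramifiedAt_heckeOfGross_of_ne` (`CharacterNormalisedGeneratorHeckeCharacter`), `modulusExp`, `modulusExp_ne_zero_iff`,
`idealPow_mul_fun'`, `idealPow_quarticResidueSymbol_pow_three`, `idealPow_primaryGen_span`, `primarize_eq_of`, `prod_embedding_zpow_embType`,
`quarticSymbol_*` (`QuarticResidueSymbolComposite`, `QuarticSymbolGaloisAndUnits`, `QuarticSymbolModulus`, `BiquadraticReciprocitySupplement`),
`quarticSymbol_span_intCast_primary_comm` (Prop. 9.9.8), `quarticResidueSymbol_sq_eq_quadraticChar`, `frobenius_gen`.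
Mathlib: `Nat.forall_exists_prime_gt_and_eq_mod` (Dirichlet), `FiniteField.exists_nonsquare`, `Ideal.mem_normalizedFactors_iff`,
`Multiset.prod_map_eq_pow_single`, `IsCyclotomicExtension.Rat.isTotallyComplex`.
-/

noncomputable section

namespace Literature.NumberTheory.GaloisRepresentations.QuarticTwistDatum

open Finset NumberField IsDedekindDomain Literature.NumberTheory.NumberFields UniqueFactorizationMonoid
open scoped ComplexConjugate

variable {K : Type} [Field K] [NumberField K]

/-! ### §1 Modulus bookkeeping -/

/-- `𝔣 ⊆ 𝔭_v^{n_v}` where `n_v = ord_v 𝔣`. [cite: NeukirchANT1999, Ch. I §3 (3.3)] -/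
theorem le_pow_modulusExp {𝔣 : Ideal (𝓞 K)} (h𝔣 : 𝔣 ≠ ⊥) (v : HeightOneSpectrum (𝓞 K)) :
    𝔣 ≤ v.asIdeal ^ modulusExp 𝔣 v := by
  have h := (Associates.prime_pow_dvd_iff_le (Associates.mk_ne_zero.mpr h𝔣)
    (Associates.irreducible_mk.mpr v.irreducible)).mpr (le_refl (modulusExp 𝔣 v))
  rw [← Associates.mk_pow, Associates.mk_le_mk_iff_dvd, Ideal.dvd_iff_le] at h
  exact h

/-- The finite set of places dividing `𝔣`. [cite: NeukirchANT1999, Ch. I §3 (3.3)] -/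
theorem mem_toFinset_factors_iff {𝔣 : Ideal (𝓞 K)} (h𝔣 : 𝔣 ≠ ⊥) (v : HeightOneSpectrum (𝓞 K)) :
    v ∈ (Ideal.finite_factors h𝔣).toFinset ↔ 𝔣 ≤ v.asIdeal := by
  rw [Set.Finite.mem_toFinset, Set.mem_setOf_eq, Ideal.dvd_iff_le]

/-- **The complementary modulus** `J_w = ∏_{v ∣ 𝔣, v ≠ w} 𝔭_v^{n_v + 8}`: it lies in `𝔭_v^{n_v}` and in `𝔭_v` for every `v ∣ 𝔣`, `v ≠ w`,
and is prime to `𝔭_w` (Chinese remainder data for the unit witnesses). [cite: NeukirchANT1999, Ch. I §3 (3.6)] -/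
theorem exists_complement {𝔣 : Ideal (𝓞 K)} (h𝔣 : 𝔣 ≠ ⊥) (w : HeightOneSpectrum (𝓞 K)) :
    ∃ J : Ideal (𝓞 K), IsCoprime w.asIdeal J ∧
      (∀ v : HeightOneSpectrum (𝓞 K), v ≠ w → 𝔣 ≤ v.asIdeal → J ≤ v.asIdeal ^ (modulusExp 𝔣 v + 8)) := by
  classical
  refine ⟨∏ v ∈ ((Ideal.finite_factors h𝔣).toFinset).erase w, v.asIdeal ^ (modulusExp 𝔣 v + 8), ?_, fun v hvw hv => ?_⟩
  · refine IsCoprime.prod_right fun v hv => IsCoprime.pow_right ?_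
    rw [Finset.mem_erase] at hv
    rw [Ideal.isCoprime_iff_sup_eq]
    exact w.isMaximal.coprime_of_ne v.isMaximal (fun h => hv.1 (HeightOneSpectrum.ext h).symm)
  · have hmem : v ∈ ((Ideal.finite_factors h𝔣).toFinset).erase w :=
      Finset.mem_erase.mpr ⟨hvw, (mem_toFinset_factors_iff h𝔣 v).mpr hv⟩
    rw [← Finset.prod_erase_mul _ _ hmem]
    exact Ideal.mul_le_left

variable [IsCyclotomicExtension {4} ℚ K] [IsPrincipalIdealRing (𝓞 K)]
variable {ζ : 𝓞 K} (hζ : IsPrimitiveRoot ζ 4)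

omit [IsPrincipalIdealRing (𝓞 K)] in
include hζ in
/-- The place `(1 + i)` of `ℚ(i)` over `2`, with `(1 + i)⁸ = (16)`, `(1+i)³ = (2+2i)` and `(1+i)² ∋ 2`. [cite: IrelandRosen1990, Ch. 9 §7 Lemma 3] -/
theorem exists_place_two :
    ∃ w₂ : HeightOneSpectrum (𝓞 K), w₂.asIdeal = Ideal.span {(1 + ζ : 𝓞 K)} ∧ (2 : 𝓞 K) ∈ w₂.asIdeal ∧
      w₂.asIdeal ^ 8 = Ideal.span {(16 : 𝓞 K)} ∧ w₂.asIdeal ^ 3 = Ideal.span {(2 + 2 * ζ : 𝓞 K)} := by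
  have hpr := prime_one_add_four hζ
  have hζ2 : ζ ^ 2 = -1 := (hζ.pow (by norm_num) (show 4 = 2 * 2 by norm_num)).eq_neg_one_of_two_right
  refine ⟨⟨Ideal.span {(1 + ζ : 𝓞 K)}, (Ideal.span_singleton_prime hpr.ne_zero).mpr hpr,
    by rw [Ne, Ideal.span_singleton_eq_bot]; exact hpr.ne_zero⟩, rfl, ?_, ?_, ?_⟩
  · rw [Ideal.mem_span_singleton]
    exact ⟨(1 - ζ), by linear_combination hζ2⟩
  · rw [Ideal.span_singleton_pow, Ideal.span_singleton_eq_span_singleton]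
    exact ⟨1, by
      have : (1 + ζ : 𝓞 K) ^ 8 = 16 * (ζ ^ 2) ^ 2 * 1 + 0 := by
        have h2 : (1 + ζ : 𝓞 K) ^ 2 = 2 * ζ := by linear_combination hζ2
        calc (1 + ζ : 𝓞 K) ^ 8 = ((1 + ζ) ^ 2) ^ 4 := by ring
          _ = (2 * ζ) ^ 4 := by rw [h2]
          _ = 16 * (ζ ^ 2) ^ 2 * 1 + 0 := by ring
      rw [this, hζ2]; simp⟩
  · rw [Ideal.span_singleton_pow, Ideal.span_singleton_eq_span_singleton]
    refine ⟨⟨ζ ^ 3, ζ, by linear_combination (ζ ^ 2 - 1) * hζ2, by linear_combination (ζ ^ 2 - 1) * hζ2⟩, ?_⟩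
    show (1 + ζ : 𝓞 K) ^ 3 * ζ ^ 3 = 2 + 2 * ζ
    linear_combination (ζ ^ 4 + 3 * ζ ^ 3 + 2 * ζ ^ 2 - 2 * ζ - 2) * hζ2

omit [IsCyclotomicExtension {4} ℚ K] [IsPrincipalIdealRing (𝓞 K)] in
include hζ in
/-- A place containing `2` is `(1 + i)`. [cite: IrelandRosen1990, Ch. 9 §7 Lemma 3] -/
theorem eq_of_two_mem {w₂ w : HeightOneSpectrum (𝓞 K)} (hw₂ : w₂.asIdeal = Ideal.span {(1 + ζ : 𝓞 K)})
    (h2 : (2 : 𝓞 K) ∈ w.asIdeal) : w = w₂ := by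
  have hζ2 : ζ ^ 2 = -1 := (hζ.pow (by norm_num) (show 4 = 2 * 2 by norm_num)).eq_neg_one_of_two_right
  have hsq : (1 + ζ : 𝓞 K) * (1 + ζ) ∈ w.asIdeal := by
    have : (1 + ζ : 𝓞 K) * (1 + ζ) = 2 * ζ := by linear_combination hζ2
    rw [this]; exact w.asIdeal.mul_mem_right _ h2
  have h1 : (1 + ζ : 𝓞 K) ∈ w.asIdeal := by
    rcases w.isPrime.mem_or_mem hsq with h | h <;> exact h
  apply HeightOneSpectrum.ext
  exact (w₂.isMaximal.eq_of_le w.isPrime.ne_top (by rw [hw₂, Ideal.span_singleton_le_iff_mem]; exact h1)).symm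

/-! ### §2 `ψ̃₀((a)) = e((D/(a))₄³) · e(a)` for `a ≡ 1 (2 + 2i)` prime to `2D` -/

include hζ in
/-- **The ideal character of the datum on a principal ideal**: for `a ≠ 0`, `a ≡ 1 (2 + 2i)` (so `a` is its own primary
generator), `ψ̃₀((a)) = e((D/(a))₄³) · e(a)`. [cite: IrelandRosen1990, Ch. 18 §6, Theorem 7 (proof: «χ(A) = \overline{(D/α)₄} α»)] -/
theorem idealPow_gen_span (e : K →+* ℂ) {D : ℤ} {a : 𝓞 K} (ha : a ≠ 0)
    (ha1 : a - 1 ∈ Ideal.span {(2 + 2 * ζ : 𝓞 K)}) :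
    LFunctions.idealPow K
        (fun v => (e (quarticResidueSymbol v (Ideal.Quotient.mk v.asIdeal (D : 𝓞 K)) ^ 3) : ℂ) *
          e (primaryGen (exists_units_mul_sub_one_mem_span_four hζ) v)) (Ideal.span {a}) =
      e (quarticSymbol (Ideal.span {a}) (D : 𝓞 K) ^ 3) * e a := by
  have hsp : Ideal.span {a} ≠ ⊥ := by rwa [Ne, Ideal.span_singleton_eq_bot]
  have hcop : IsCoprime (Ideal.span {a}) (Ideal.span {(2 + 2 * ζ : 𝓞 K)}) :=
    isCoprime_span_of_sub_one_mem_span ha1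
  rw [idealPow_mul_fun' _ _ hsp, idealPow_quarticResidueSymbol_pow_three e _ hsp,
    idealPow_primaryGen_span (exists_units_mul_sub_one_mem_span_four hζ) (units_eq_one_of_sub_one_mem_span_four hζ)
      (span_two_add_ne_bot hζ) e ha hcop,
    primarize_eq_of (exists_units_mul_sub_one_mem_span_four hζ) (units_eq_one_of_sub_one_mem_span_four hζ) hcop rfl ha1]

omit [IsCyclotomicExtension {4} ℚ K] [IsPrincipalIdealRing (𝓞 K)] in
/-- The right-hand side of the unit-witness criterion for the type `(embType e, embTypeConj e)` is `e(a)`.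
[cite: NeukirchANT1999, Ch. VII §6 Def. (6.1)] -/
theorem prod_embedding_eq (e : K →+* ℂ) (a : 𝓞 K) :
    ∏ w' : InfinitePlace K, w'.embedding (a : K) ^ embType e w' * conj (w'.embedding (a : K)) ^ embTypeConj e w' = e a :=
  prod_embedding_zpow_embType e (a : K)

/-! ### §3 The prime over `2` -/

omit [IsCyclotomicExtension {4} ℚ K] [IsPrincipalIdealRing (𝓞 K)] in
/-- A rational prime `ℓ` under a place `v ∣ (8D)` divides `8D`. [cite: IrelandRosen1990, Ch. 18 §6, Theorem 7] -/
theorem exists_prime_mem {D : ℤ} {v : HeightOneSpectrum (𝓞 K)}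
    (hv : Ideal.span {((8 * D : ℤ) : 𝓞 K)} ≤ v.asIdeal) :
    ∃ ℓ : ℕ, ℓ.Prime ∧ (ℓ : 𝓞 K) ∈ v.asIdeal ∧ (ℓ : ℤ) ∣ 8 * D := by
  classical
  haveI : Finite (𝓞 K ⧸ v.asIdeal) := Ideal.finiteQuotientOfFreeOfNeBot v.asIdeal v.ne_bot
  letI : Fintype (𝓞 K ⧸ v.asIdeal) := Fintype.ofFinite _
  letI : Field (𝓞 K ⧸ v.asIdeal) := Ideal.Quotient.field _
  obtain ⟨n, hℓ, -⟩ := FiniteField.card (𝓞 K ⧸ v.asIdeal) (ringChar (𝓞 K ⧸ v.asIdeal))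
  set ℓ := ringChar (𝓞 K ⧸ v.asIdeal)
  have hℓv : ((ℓ : ℕ) : 𝓞 K) ∈ v.asIdeal := by
    rw [← Ideal.Quotient.eq_zero_iff_mem, map_natCast]
    exact ringChar.Nat.cast_ringChar
  refine ⟨ℓ, hℓ, hℓv, ?_⟩
  by_contra hnd
  exact intCast_notMem hℓ hnd hℓv ((Ideal.span_singleton_le_iff_mem _).mp hv)

include hζ in
/-- ★ **`ψ` is ramified at the prime over `2`.** Witness: a Dirichlet prime `q ≡ 3 (4)`, `q ≡ 1 (mod |D|ᴺ_odd)`, `q > 8|D|`: `q` is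
prime to `(8D)`, `q ≡ 1` to the order `n_v` at every odd `v ∣ 8D`, and `ψ̃₀((q)) = ψ₀((q)) = −q ≠ q = e(q)` (`(q)` is inert, the
primary generator is `−q`, `(D/q)₄ = 1`). [cite: IrelandRosen1990, Ch. 18 §7 (the conductor of χ is divisible by (1+i))] [cite: SilvermanATAEC1994, Ch. II Thm. 10.5] -/
theorem not_isUnramifiedAt_gen_two (e : K →+* ℂ) {D : ℤ} (hD : D ≠ 0) {w : HeightOneSpectrum (𝓞 K)}
    (h2w : (2 : 𝓞 K) ∈ w.asIdeal) :
    ¬ (heckeOfGross (span_ne_bot hD) (isGrossencharakter_gen hζ e hD)).IsUnramifiedAt w := by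
  classical
  haveI : IsTotallyComplex K := IsCyclotomicExtension.Rat.isTotallyComplex K (by norm_num : 2 < 4)
  set 𝔣 : Ideal (𝓞 K) := Ideal.span {((8 * D : ℤ) : 𝓞 K)} with h𝔣def
  have h𝔣 : 𝔣 ≠ ⊥ := span_ne_bot hD
  have hψ := isGrossencharakter_gen hζ e hD
  obtain ⟨c, hc⟩ := exists_algEquiv_ne_one_four (K := K)
  -- `𝔣 ≤ w`
  have h𝔣w : 𝔣 ≤ w.asIdeal := by
    rw [h𝔣def, Ideal.span_singleton_le_iff_mem, show ((8 * D : ℤ) : 𝓞 K) = 2 * ((4 * D : ℤ) : 𝓞 K) by push_cast; ring]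
    exact w.asIdeal.mul_mem_right _ h2w
  -- the odd part of `D` and the exponent `N`
  obtain ⟨j, d, hdodd, hDd⟩ := Nat.exists_eq_two_pow_mul_odd (Int.natAbs_ne_zero.mpr hD)
  set S := (Ideal.finite_factors h𝔣).toFinset with hS
  set N : ℕ := (∑ v ∈ S, modulusExp 𝔣 v) + 1 with hN
  set M : ℕ := d ^ N with hM
  have hModd : Odd M := hdodd.pow
  have hd0 : d ≠ 0 := by rintro rfl; simp at hdodd
  -- the residue class `r = 1 + 2M` mod `4M`: `≡ 3 (4)`, `≡ 1 (M)`
  have hodd12 : ¬ 2 ∣ 1 + 2 * M := by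
    obtain ⟨k, hk⟩ := hModd
    rw [hk]; omega
  have hcopr : Nat.Coprime (1 + 2 * M) (4 * M) := by
    refine Nat.Coprime.mul_right ?_ ((Nat.coprime_add_mul_right_left 1 M 2).mpr (Nat.coprime_one_left M))
    rw [show (4 : ℕ) = 2 ^ 2 by norm_num]
    exact Nat.Coprime.pow_right 2 ((Nat.prime_two.coprime_iff_not_dvd).mpr hodd12).symm
  have hM0 : M ≠ 0 := pow_ne_zero _ hd0
  haveI : NeZero (4 * M) := ⟨Nat.mul_ne_zero (by norm_num) hM0⟩
  have hunit : IsUnit (((1 + 2 * M : ℕ)) : ZMod (4 * M)) := (ZMod.isUnit_iff_coprime _ _).mpr hcopr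
  obtain ⟨q, hqgt, hq, hqmod⟩ := Nat.forall_exists_prime_gt_and_eq_mod hunit (8 * D).natAbs
  have hqmod' : q ≡ 1 + 2 * M [MOD 4 * M] := (ZMod.natCast_eq_natCast_iff _ _ _).mp hqmod
  have hq4 : q % 4 = 3 := by
    have h := (hqmod'.of_mul_right M : q ≡ 1 + 2 * M [MOD 4])
    obtain ⟨k, hk⟩ := hModd
    unfold Nat.ModEq at h
    rw [hk] at h
    omega
  have hq2 : q ≠ 2 := by rintro rfl; norm_num at hq4
  have hq1 : 1 ≤ q := hq.one_lt.le
  have hMq : M ∣ q - 1 := by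
    have h := (hqmod'.of_mul_left 4 : q ≡ 1 + 2 * M [MOD M])
    have h' : q ≡ 1 [MOD M] := h.trans (by
      have : 1 + 2 * M ≡ 1 + 0 [MOD M] := (Nat.ModEq.refl 1).add (Nat.modEq_zero_iff_dvd.mpr ⟨2, by ring⟩)
      rwa [add_zero] at this)
    exact (Nat.modEq_iff_dvd' hq1).mp h'.symm
  -- `q ∤ 8D`, `q ∤ 2D`
  have h8D0 : (8 * D) ≠ 0 := by omega
  have hq8D : ¬ (q : ℤ) ∣ 8 * D := fun h => by
    have h1 := Int.le_of_dvd (abs_pos.mpr h8D0) ((dvd_abs _ _).mpr h)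
    rw [Int.abs_eq_natAbs] at h1
    have h2 : q ≤ (8 * D).natAbs := by exact_mod_cast h1
    omega
  have hq2D : ¬ (q : ℤ) ∣ 2 * D := fun h => hq8D (by
    rw [show (8 : ℤ) * D = 4 * (2 * D) by ring]; exact dvd_mul_of_dvd_right h 4)
  -- `w` is the place over `2`
  obtain ⟨w₂, hw₂, -, -, -⟩ := exists_place_two (K := K) hζ
  have hww₂ : w = w₂ := eq_of_two_mem hζ hw₂ h2w
  -- the inert place `v_q = (q)`
  haveI := Fact.mk hq
  have hqprime : Prime (q : 𝓞 K) := prime_natCast_of_mod_four_eq_three hq hq4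
  let vq : HeightOneSpectrum (𝓞 K) :=
    ⟨Ideal.span {(q : 𝓞 K)}, (Ideal.span_singleton_prime hqprime.ne_zero).mpr hqprime,
      by rw [Ne, Ideal.span_singleton_eq_bot]; exact hqprime.ne_zero⟩
  have hqv : (q : 𝓞 K) ∈ vq.asIdeal := Ideal.mem_span_singleton_self _
  have hfix : c • vq = vq := smul_eq_self_of_mod_four_eq_three hq hq4 c hqv
  have hval := ((frobenius_gen hζ e hc hq2D hqv).2.2 hfix).2
  -- the unit-witness criterion with `a = q`
  refine not_isUnramifiedAt_heckeOfGross_of_ne h𝔣 hψ h𝔣w (a := (q : 𝓞 K)) ?_ ?_ ?_ ?_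
  · -- `q ∉ w` (`w ∋ 2`, `q` odd)
    have h := intCast_notMem (K := K) Nat.prime_two (n := q) (by exact_mod_cast fun h : 2 ∣ q => hq2 ((Nat.prime_dvd_prime_iff_eq Nat.prime_two hq).mp h).symm)
      (by exact_mod_cast h2w)
    exact_mod_cast h
  · -- `(q)` is prime to `(8D)`
    rw [h𝔣def, Ideal.isCoprime_span_singleton_iff]
    have hcz : IsCoprime (q : ℤ) (8 * D) := (Prime.coprime_iff_not_dvd (Nat.prime_iff_prime_int.mp hq)).mpr hq8D
    have := hcz.map (Int.castRingHom (𝓞 K))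
    simpa using this
  · -- `q ≡ 1` to order `n_v` at every `v ∣ 8D`, `v ≠ w`
    intro v hvw hv
    have hle : 𝔣 ≤ v.asIdeal := (modulusExp_ne_zero_iff _ h𝔣 v).mp hv
    have hvS : v ∈ S := (mem_toFinset_factors_iff h𝔣 v).mpr hle
    have h2v : (2 : 𝓞 K) ∉ v.asIdeal := fun h => hvw (by rw [hww₂]; exact eq_of_two_mem hζ hw₂ h)
    obtain ⟨ℓ, hℓ, hℓv, hℓD⟩ := exists_prime_mem hle
    have hℓ2 : ℓ ≠ 2 := by rintro rfl; exact h2v (by exact_mod_cast hℓv)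
    -- `ℓ ∣ d`
    have hℓd : ℓ ∣ d := by
      have hℓD' : ℓ ∣ (8 * D).natAbs := Int.natCast_dvd.mp hℓD
      rw [Int.natAbs_mul, hDd, show (8 : ℤ).natAbs = 2 ^ 3 by rfl, ← mul_assoc, ← pow_add] at hℓD'
      rcases (Nat.Prime.dvd_mul hℓ).mp hℓD' with h | h
      · exact absurd ((Nat.prime_dvd_prime_iff_eq hℓ Nat.prime_two).mp (hℓ.dvd_of_dvd_pow h)) hℓ2
      · exact h
    -- `ℓ^N ∣ M ∣ q - 1`, and `n_v < N`
    have hℓN : ℓ ^ N ∣ q - 1 := (pow_dvd_pow_of_dvd hℓd N).trans hMq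
    have heN : modulusExp 𝔣 v ≤ N := by
      have := Finset.single_le_sum (f := fun v => modulusExp 𝔣 v) (fun _ _ => Nat.zero_le _) hvS
      omega
    obtain ⟨t, ht⟩ := hℓN
    have hcast : (q : 𝓞 K) - 1 = ((ℓ : 𝓞 K)) ^ N * (t : 𝓞 K) := by
      have : ((q - 1 : ℕ) : 𝓞 K) = ((ℓ ^ N * t : ℕ) : 𝓞 K) := by rw [ht]
      push_cast [Nat.cast_sub hq1] at this
      exact this
    rw [hcast]
    exact Ideal.pow_le_pow_right heN (Ideal.mul_mem_right _ _ (Ideal.pow_mem_pow hℓv N))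
  · -- `ψ̃₀((q)) = −q ≠ q`
    rw [prod_embedding_eq, show Ideal.span {(q : 𝓞 K)} = vq.asIdeal from rfl, LFunctions.idealPow_asIdeal, hval]
    push_cast
    rw [map_natCast]
    have : (q : ℂ) ≠ 0 := by exact_mod_cast hq.ne_zero
    intro h
    exact this (by linear_combination (-(1 : ℂ) / 2) * h)

end Literature.NumberTheory.GaloisRepresentations.QuarticTwistDatum
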